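import Summits.ABC.ABC.Theses.TwistAmplification
import Literature.NumberTheory.DiophantineGeometry.AbcShapeCount

/-!
# The lever `LevelTorsorBound` of line `peyre-level-torsor-v22` contains the Pell box count (crux stmt-ABC-2757)

A HARDNESS CERTIFICATE for the registered lever of the line (lead prover-line-stmt-ABC-2757-0, 2026-08-16).
The lever `LevelTorsorBound` (Le Boudec's torsor count on `V₂² : x₀y₀² + x₁y₁² + x₂y₂² = 0` at `d = 2`, level
aspect, MAX-form: `shapeCount f X Y Z ≤ K (f₃Z₀Z₁²)^ε (1 + X₀X₁Y₀Y₁Z₀Z₁/(f₃Z₀Z₁²))` uniformly in `f` and in the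
boxes) specialises, at `f = (1,1,1)`, `X = (D, U)`, `Y = (1, 1)`, `Z = (1, T)`, to a bound for the PELL BOX COUNT
`#{(d,u,t) ∈ [D,2D) × [U,2U) × [T,2T) : t² = d·u² + 1} ≤ K · T^{2ε} · (1 + DU/T)`
(`LeverPellBox`, registered name). With `T ≍ U√D` (the only non-empty range) the right-hand side
is `≍ D^{1/2} T^{2ε}` UNIFORMLY IN `U`; since each `d` has `O(1)` Pell solutions `(t,u)` with `u` in a dyadic range,
the left-hand side is `≍ #{d ∈ [D,2D) non-square : t² - du² = 1 has a solution with u ∈ [U,2U)}`, and summing over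
dyadic `U ≤ D^α` this is Hooley's count `S(x, α) = #{d ≤ x : ε_d ≤ d^{1/2+α}}` up to `x^{O(ε)}`. Hooley (J. reine
angew. Math. 353 (1984)) PROVED `S(x,α) ~ (4α²/π²) √x log² x` for `0 < α ≤ 1/2` and CONJECTURED `S(x,α) ≍_α √x log² x`
for `α > 1/2`; for `α > 1/2` the best upper bounds are `x^{α/3+7/12+ε}` (Fouvry–Jouve, Math. Z. 273 (2013)) and the
refinements of Reuss (arXiv:1212.3150) — see also Fouvry, J. reine angew. Math. 717 (2016), Bourgain (arXiv:1311.5911),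
Xi (arXiv:1704.04916), Diao (arXiv:2408.03774: `#{t² - du² = 1, |t|,|d|,|u| ≤ B} ≪ B^{7/12+ε}`, and `≪ B^{1/2} log² B`
only under Hooley's conjecture). CONSEQUENCE FOR THE LINE: the lever as registered implies the upper-bound half of
Hooley's conjecture for every `α`, an open problem since 1984 that is IRRELEVANT to the line's target range (Pell
triples `(du², 1, t²)` have abc exponent `≤ 3/2 + o(1)`, below the slices `[5/3, 2)` the lever serves; there the
trivial divisor bound `≤ T^{1+ε}` already suffices for what `SliceClassBound` consumes). Hence the lead's reshape of
the line: the registered high-range stub becomes the slice law `SliceLawHigh` itself (Hooley-free), with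
`LevelTorsorBound ⟹ SliceLawHigh` kept as a kernel-checked sufficient route.
-/

namespace Summit.ABC.ABC.Theorems

open Finset
open Literature.NumberTheory.DiophantineGeometry
open Literature.NumberTheory.DiophantineGeometry.AbcShapes

/-- `shapeVal` of a `Fin 2` tuple: `![a, b] ↦ a · b²`. [folklore] -/
theorem MazurKaneLaw.shapeVal_vec2 (a b : ℕ) : shapeVal ![a, b] = a * b ^ 2 := by
  simp [shapeVal, Fin.prod_univ_two]

/-- `shapeProd` of a `Fin 2` tuple: `![a, b] ↦ a · b`. [folklore] -/
theorem MazurKaneLaw.shapeProd_vec2 (a b : ℕ) : shapeProd ![a, b] = a * b := by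
  simp [shapeProd, Fin.prod_univ_two]

/-- Membership of a `Fin 2` tuple in a `Fin 2` dyadic box. [folklore] -/
theorem MazurKaneLaw.vec2_mem_dyadicBox {a b A B : ℕ} (ha : A ≤ a ∧ a < 2 * A) (hb : B ≤ b ∧ b < 2 * B) :
    (![a, b] : Fin 2 → ℕ) ∈ dyadicBox ![A, B] := by
  rw [mem_dyadicBox]
  intro i
  fin_cases i
  · simpa using ha
  · simpa using hb

/-- **The Pell box embeds into the `d = 2` shape count**: `(d, u, t) ↦ (x, y, z) = ((d, u), (1, 1), (1, t))` maps
`{(d,u,t) ∈ [D,2D) × [U,2U) × [T,2T) : t² = d u² + 1}` injectively into `shapeTriples 1 1 1 (D,U) (1,1) (1,T)`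
(equation `d·u² + 1·1² = 1·t²`; the gcd condition holds because the middle term is `1`). [folklore] -/
theorem MazurKaneLaw.card_pellBox_le_shapeCount (D U T : ℕ) :
    ((Ico D (2 * D) ×ˢ Ico U (2 * U) ×ˢ Ico T (2 * T)).filter
        (fun p => p.2.2 ^ 2 = p.1 * p.2.1 ^ 2 + 1)).card ≤
      shapeCount 1 1 1 ![D, U] ![1, 1] ![1, T] := by
  classical
  rw [shapeCount]
  refine card_le_card_of_injOn
    (fun p : ℕ × ℕ × ℕ => ((![p.1, p.2.1] : Fin 2 → ℕ), (![1, 1] : Fin 2 → ℕ), (![1, p.2.2] : Fin 2 → ℕ)))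
    (fun p hp => ?_) (fun p hp p' hp' h => ?_)
  · obtain ⟨hbox, heq⟩ := mem_filter.mp (mem_coe.mp hp)
    simp only [mem_product, mem_Ico] at hbox
    obtain ⟨hd, hu, ht⟩ := hbox
    refine mem_coe.mpr (mem_filter.mpr ⟨?_, ?_, ?_⟩)
    · simp only [mem_product]
      exact ⟨MazurKaneLaw.vec2_mem_dyadicBox hd hu,
        MazurKaneLaw.vec2_mem_dyadicBox ⟨le_rfl, by norm_num⟩ ⟨le_rfl, by norm_num⟩,
        MazurKaneLaw.vec2_mem_dyadicBox ⟨le_rfl, by norm_num⟩ ht⟩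
    · rw [MazurKaneLaw.shapeVal_vec2, MazurKaneLaw.shapeVal_vec2, MazurKaneLaw.shapeVal_vec2]
      simp only [one_mul, one_pow]
      omega
    · rw [MazurKaneLaw.shapeProd_vec2, MazurKaneLaw.shapeProd_vec2, MazurKaneLaw.shapeProd_vec2]
      simp
  · simp only [Prod.mk.injEq] at h
    obtain ⟨h1, -, h3⟩ := h
    have e1 : p.1 = p'.1 := by simpa using congrFun h1 0
    have e2 : p.2.1 = p'.2.1 := by simpa using congrFun h1 1
    have e3 : p.2.2 = p'.2.2 := by simpa using congrFun h3 1
    exact Prod.ext e1 (Prod.ext e2 e3)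

/-- **The lever contains the Pell box bound** (registered name `LeverPellBox`). If `LevelTorsorBound` (the
registered lever of line `peyre-level-torsor-v22`, verbatim) holds, then for every `ε > 0` there is `K` with
`#{(d,u,t) ∈ [D,2D) × [U,2U) × [T,2T) : t² = d u² + 1} ≤ K · (T²)^ε · (1 + D·U·T/T²)` for all positive `D, U, T` —
for `T ≍ U√D` the right-hand side is `≍ K T^{2ε} √D` uniformly in `U`, i.e. the upper-bound half of Hooley's
conjecture on the size of the fundamental solution of the Pell equation for every exponent `α` (see the module
docstring; proved only for `α ≤ 1/2`, Hooley 1984). [folklore] -/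
theorem LeverPellBox : (∀ ε : ℝ, 0 < ε → ∃ K : ℝ, ∀ (f₁ f₂ f₃ : ℕ) (X Y Z : Fin 2 → ℕ), 0 < f₁ → 0 < f₂ → 0 < f₃ → (∀ i, 0 < X i) → (∀ i, 0 < Y i) → (∀ i, 0 < Z i) → (Literature.NumberTheory.DiophantineGeometry.AbcShapes.shapeCount f₁ f₂ f₃ X Y Z : ℝ) ≤ K * ((f₃ : ℝ) * ((Literature.NumberTheory.DiophantineGeometry.AbcShapes.shapeVal Z : ℕ) : ℝ)) ^ ε * (1 + ((X 0 : ℝ) * X 1 * Y 0 * Y 1 * Z 0 * Z 1) / ((f₃ : ℝ) * ((Literature.NumberTheory.DiophantineGeometry.AbcShapes.shapeVal Z : ℕ) : ℝ)))) → ∀ ε : ℝ, 0 < ε → ∃ K : ℝ, ∀ D U T : ℕ, 0 < D → 0 < U → 0 < T → ((((Finset.Ico D (2 * D) ×ˢ Finset.Ico U (2 * U) ×ˢ Finset.Ico T (2 * T)).filter (fun p => p.2.2 ^ 2 = p.1 * p.2.1 ^ 2 + 1)).card : ℕ) : ℝ) ≤ K * ((T : ℝ) ^ 2) ^ ε * (1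 + (D : ℝ) * U * T / (T : ℝ) ^ 2) := by
  intro h ε hε
  obtain ⟨K, hK⟩ := h ε hε
  refine ⟨K, fun D U T hD hU hT => ?_⟩
  have hX : ∀ i : Fin 2, 0 < (![D, U] : Fin 2 → ℕ) i := by
    intro i; fin_cases i
    · simpa using hD
    · simpa using hU
  have hY : ∀ i : Fin 2, 0 < (![1, 1] : Fin 2 → ℕ) i := by
    intro i; fin_cases i <;> simp
  have hZ : ∀ i : Fin 2, 0 < (![1, T] : Fin 2 → ℕ) i := by
    intro i; fin_cases i
    · simp
    · simpa using hT
  have h1 := hK 1 1 1 ![D, U] ![1, 1] ![1, T] one_pos one_pos one_pos hX hY hZ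
  have h2 : ((((Ico D (2 * D) ×ˢ Ico U (2 * U) ×ˢ Ico T (2 * T)).filter
      (fun p => p.2.2 ^ 2 = p.1 * p.2.1 ^ 2 + 1)).card : ℕ) : ℝ) ≤
      (shapeCount 1 1 1 ![D, U] ![1, 1] ![1, T] : ℝ) := by
    exact_mod_cast MazurKaneLaw.card_pellBox_le_shapeCount D U T
  have h3 : K * (((1 : ℕ) : ℝ) * ((shapeVal ![1, T] : ℕ) : ℝ)) ^ ε *
      (1 + (((![D, U] : Fin 2 → ℕ) 0 : ℕ) : ℝ) * (((![D, U] : Fin 2 → ℕ) 1 : ℕ) : ℝ) *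
        (((![1, 1] : Fin 2 → ℕ) 0 : ℕ) : ℝ) * (((![1, 1] : Fin 2 → ℕ) 1 : ℕ) : ℝ) *
        (((![1, T] : Fin 2 → ℕ) 0 : ℕ) : ℝ) * (((![1, T] : Fin 2 → ℕ) 1 : ℕ) : ℝ) /
        (((1 : ℕ) : ℝ) * ((shapeVal ![1, T] : ℕ) : ℝ))) =
      K * ((T : ℝ) ^ 2) ^ ε * (1 + (D : ℝ) * U * T / (T : ℝ) ^ 2) := by
    rw [MazurKaneLaw.shapeVal_vec2]
    simp only [Matrix.cons_val_zero, Matrix.cons_val_one, Nat.cast_one,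
      one_mul, mul_one, Nat.cast_pow]
  rw [h3] at h1
  exact h2.trans h1

end Summit.ABC.ABC.Theorems
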